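import Summits.ValiantsHypothesis.ValiantsHypothesis.Theorems.BarrierLeverAnchoredDoorHitsLowerPairsStarLowerRefutation
import Summits.ValiantsHypothesis.ValiantsHypothesis.Theorems.BarrierLeverAnchoredDoorHitsLowerPairsStarHybridNode
import Summits.ValiantsHypothesis.ValiantsHypothesis.Theorems.BarrierLeverAnchoredDoorHitsLowerPairsStarRigid
import Summits.ValiantsHypothesis.ValiantsHypothesis.Theorems.BarrierLeverAnchoredDoorHitsLowerPairsStarRigidTN

/-!
# Route BarrierLever — support item `AnchoredDoorHitsLowerPairs` (stmt-ValiantsHypothesis-22510), line `anchored_peeling`: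
# corollaries of `not_conjStarLower` for the remaining STAR nodes (val-np-p1 g36)

Helper file (`--supports stmt-ValiantsHypothesis-22510`). Closes NO item; the ITEM is not refuted; nothing here bears on crux 14610 or on `VP ≠ VNP`,
which is NOT proved. Every node that implies `Stmt.conjStarLower` by a landed arrow is false: the hybrid-certificate conjectures HC
(`Stmt.conjStarHybrid`, `Stmt.conjStarHybridRigid`, …StarHybridNode), the rigid reductions (`Stmt.conjStarRigid`, …StarRigid; `Stmt.conjStarTNRigid`,
…StarRigidTN). The counterexample of …StarLowerRefutation — rows all faces of size ≤ 3 on 45 vertices, columns all faces of size ≤ 2 on 174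
vertices — is itself vertex–face rigid (link sizes 991 / 44 / 1 on one side, 174 / 1 on the other), so it is also a direct witness for the rigid nodes.
-/

set_option linter.dupNamespace false

namespace Summit.ValiantsHypothesis.ValiantsHypothesis.Theorems.BarrierLever.AnchoredPeeling

/-- The hybrid-certificate conjecture HC (`Stmt.conjStarHybrid`, …StarHybridNode) is false. -/
theorem not_conjStarHybrid : ¬ Stmt.conjStarHybrid := fun H => not_conjStarLower (conjStarLower_of_conjStarHybrid H)

/-- `Stmt.conjStarHybridRigid` (…StarHybridNode) is false. -/
theorem not_conjStarHybridRigid : ¬ Stmt.conjStarHybridRigid := fun H => not_conjStarLower (conjStarLower_of_conjStarHybridRigid H)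

/-- `Stmt.conjStarRigid` (…StarRigid: STAR-LOWER on vertex–face-rigid pairs) is false. -/
theorem not_conjStarRigid : ¬ Stmt.conjStarRigid := fun H => not_conjStarLower (conjStarLower_of_conjStarRigid H)

/-- `Stmt.conjStarTNRigid` (…StarRigidTN) is false. -/
theorem not_conjStarTNRigid : ¬ Stmt.conjStarTNRigid := fun H => not_conjStarTN (conjStarTN_of_conjStarTNRigid H)

end Summit.ValiantsHypothesis.ValiantsHypothesis.Theorems.BarrierLever.AnchoredPeeling
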